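import Summits.QuantumFields.YangMills.Theorems.BalabanUVNodesN12BjAcrossChains
import Literature.MathematicalPhysics.QuantumFieldTheory.Balaban1983to89.B15DeterminingSetsBEndpoints
import HarnessLib

/-!
# BalabanUVNodes ∕ N12 — (G-c)ᴸᵃᵐ part 1∕2: CHAINS ACROSS `∂Ω_{n+1}` AT PRINT's DATUM `Λ_j(Z) = lamBondsSeq (maxDomT M₁ Z) k j` ([Balaban1984PropagatorsII] (2.3)) — the membership
# certificates (which links of dag-n12-w3's chains are PRINT members: the outward connector, the fine links inside the outside neighbour block, a same-level link between two `Γ_J`-blocks;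
# the face-layer alternative of the (CENTRE) clause is VOID) and `…N12BjAcrossChains.exists_chain_across(_graded)` RE-CERTIFIED LINK BY LINK — the first (F) head of the (ii) re-attachment of
# N12's road at print's datum (dag-lead WORDS 423, pub-ymgap INBOX 2026-08-30: «O3 = n12-c takes a share of (F), bottom-up at the print-root graph-combinatorics heads»)

[Balaban1984PropagatorsII] = «[II]», (2.3) p. 224 (print's `Λ_j`: the bonds of the `j`-lattice in `Ω_j ∖ Ω_{j+1}` together with the OUTWARD connectors; the inward connectors — a `j`-bond
with an end-point block deep in `Ω_{j+1}` — are NOT constrained); [Balaban1988Convergent] = «[III]», (2.2) p. 255, (2.13) pp. 256–257 (the maximal sequence `Ω_j(Z)`, the collar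
`dist(Ω_{j+1}, Ω_jᶜ) ≥ L^{j+1}M₁`); [Balaban1985Variational] = «[15]», (3)–(4) p. 278, (16)–(18) p. 280 (the residual axial gauge between the points of `𝔅_k`, read along chains of constrained
bonds); [Balaban1985RegularSpaces] = «[6]», (1.7) p. 77, (1.19) p. 79.

Cell `pub-ymgap` (HUMAN RULINGS D-0062 ∕ D-0149), lane `pub-ymgap-dag-n12-c` g37 (R134 seat (a), N12 = [B15], s1, lane owner; (F)-share by dag-lead WORDS 423); `--kind proof --supports` K1⁹
`stmt-QuantumFields-27364` `--as helper`; count-neutral.  THEOREMS ONLY (0 `def`, 0 `instance`, 0 `sorry`); by name over dag-n12-w3's `…N12BjAcrossChains` (`mem_Bj_pred_of_outside`,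
`mem_bondsOf_of_outside`, `embIter_not_mem_maxDomT_succ`, `iterBlockOf_ne_of_mem_not_mem`, the one-link lemmas), `…N12BjCollarRoots`, `…N12BlockChains`, `…N12BjRootChainsGraded`
(statement shapes), `…N12FlatHndRecordLetters.hcov_Bj`, and this lane's ✓p776611∕p776747 `B15DeterminingSetsBEndpoints` (the MEMBERSHIP CRITERION `mem_lamBondsSeq_maxDomT_of_embIter_not_mem`
and `embIter_not_mem_of_mem_lamBondsSeq`).  §2∕§3∕§5 are the parents' proof texts (tree bytes, block-extracted by `work/gen_rootchains_lam.py`) with the two membership certificates exchanged.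

WHY.  dag-n12-w6's root-transporter letter `hT` (`…N12RootTransporterBj(B)`: the transport of `U₀` along a chain of constrained bonds is within `#links·θ` of a product of the member
AVERAGES, themselves `δ₁`-near `1` by the DATUM letter) needs, at print's datum, chains whose links are PRINT members: the (2.12) constraint `M_Λ(U₀) = V` pins the averages of the minimiser
ONLY on `Λ_j(Z)`'s bonds (the lane's LOCATED of 2026-08-30: the inward connectors are free variables of print's variational problem), so the (b)-chains of `…N12BjRootChains` — which reach a
face-layer root through the INWARD connector — do not carry the datum letter.  THIS FILE shows the repair costs nothing: (i) the coarse link of a chain across `∂Ω_{n+1}` is the OUTWARD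
connector (both end-centres off `Ω_{n+2}` ∕ `Ω_{n+1}`), the fine links inside the outside neighbour block have both end-centres off `Ω_{n+1}`, and a same-level link between two
`Γ_J`-blocks has both end-centres off `Ω_{J+1}` — all PRINT members by the lane's membership criterion; (ii) at print's datum the (CENTRE) clause's face-layer alternative never fires
(`not_faceLayer_lamBondsSeq`), i.e. EVERY root is the centre `ι_J(B^J z)` of the `Γ`-level block — print's root set `{ι_j c± : c ∈ Λ_j}` contains every `Γ_j^{(j)}`-centre
(`B15DeterminingSetsBEndpoints.exists_mem_lamBondsSeq_maxDomT_of_mem_Bj`) and no face-layer point —, so the root chain IS the centre-to-centre chain.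

CONTENTS (namespace `Summit.QuantumFields.YangMills.BalabanUVNodes.N12BjAcrossChainsLam`).  §1 membership certificates at `Z`'s maximal sequence: `mem_lamBondsSeq_of_outside` (level-`n`
bonds inside the outside neighbour block), ★ `connector_mem_lamBondsSeq` (the outward connector), ★ `adjacent_mem_lamBondsSeq` (a `J`-bond with both ends in `Γ_J`), ★ `not_faceLayer_lamBondsSeq`
(no `Λ_{J−1}`-bond touches the `(J−1)`-block under a `Γ_J`-block), `root_eq_centre_of_hcentre_lam` (the print (CENTRE) clause forces `root z = ι_J(B^J z)`).  §2 ★★ `exists_chain_across_lam_graded`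
(the parent's proof text, tree bytes block-extracted by `work/gen_rootchains_lam.py`, with the two membership certificates exchanged) + the ungraded `exists_chain_across_lam`.
Part 2∕2 (`…N12BjRootChainsLam`): centre-to-centre, root-to-centre (empty) and the root chains.

HONEST FRAMING.  Finite lattice bookkeeping by name over landed kernel theorems; no analysis; nothing of Bałaban's estimates asserted or refuted; count-neutral helper (`--supports 27364`);
N12 NOT discharged; K0⁷∕K1⁹ NOT closed; counts of record unmoved (typed 28∕28 · discharged 8∕27); one finite 𝕋⁴ programme at fixed ε — R4 closes the conditional rung `BalabanLadder.UV`
only; the Yang–Mills mass gap (Clay) is NOT proved by any of this; nothing continuum ∕ ℝ⁴ ∕ OS.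
-/

noncomputable section

namespace Summit.QuantumFields.YangMills.BalabanUVNodes.N12BjAcrossChainsLam

open scoped BigOperators
open Literature.MathematicalPhysics.QuantumFieldTheory.Balaban1983to89
open T4Continuum
open B15DeterminingSets B15DeterminingSetsB
open B15DeterminingSetsBEndpoints (mem_lamBondsSeq_maxDomT_of_embIter_not_mem embIter_not_mem_of_mem_lamBondsSeq)
open B5Eq118OneStroke (iterBlockOf iterBlockOf_succ)
open B14.Eq213MaximalDomains (side)
open B14.Eq213DetSet (Bj Bj_zero Bj_mid Bj_top Bj_of_gt maxDomT maxDomT_antitone isBlockUnion_maxDomT)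
open Literature.MathematicalPhysics.QuantumFieldTheory.BalabanImbrieJaffe1984to88.BIJ88RT51Background (iterBlockOf_embIter)
open Summit.QuantumFields.YangMills.BalabanUVNodes.N07CritMultiScaleLamBond (iterBlockOf_congr_of_le)
open Summit.QuantumFields.YangMills.BalabanUVNodes.N12FlatHndRecordLetters (hcov_Bj)
open Summit.QuantumFields.YangMills.BalabanUVNodes.N12BjCollarRoots
open Summit.QuantumFields.YangMills.BalabanUVNodes.N12BlockChains
open Summit.QuantumFields.YangMills.BalabanUVNodes.N12BjAcrossChains
open B6CubeRightLegsV1 (iterBlockOf_shift_or)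

variable {P : Params}

/-! ## §1  Membership certificates at `Z`'s maximal sequence: which links are PRINT members -/

section Membership

variable {M₁ k : ℕ} {Z : Set (Site P 0)}

/-- **THE FINE LINKS INSIDE THE OUTSIDE NEIGHBOUR BLOCK ARE PRINT MEMBERS.**  In the data of `N12BjAcrossChains.mem_bondsOf_of_outside` (the `(n+1)`-block of `x` a member, `w ∉ Ω_{n+1}`, a
level-`(n+1)` bond `C` joining the two blocks), a level-`n` bond with BOTH ends in the `(n+1)`-block of `w` is a bond of `Λ_n(Z)`: it meets `Γ_n` (the parent) and both end-centres lie in the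
block of `w`, off `Ω_{n+1}` (block union). [cite: Balaban1984PropagatorsII, (2.3) p.224; Balaban1988Convergent, (2.2) p.255, (2.13) pp.256–257] -/
theorem mem_lamBondsSeq_of_outside (hM2 : 2 ≤ M₁) (hdiv : side P.L M₁ k ∣ P.sitesPerDir 0) (hk : k ≤ P.m + P.K) {n : ℕ} (hn : n + 1 ≤ k)
    {x w : Site P 0} (hx : iterBlockOf (n + 1) x ∈ (Bj M₁ Z k : DetSet P) (n + 1)) (hw : w ∉ maxDomT M₁ Z (n + 1))
    (C : PBond P (n + 1)) (hC : (C.src = iterBlockOf (n + 1) x ∧ C.tgt = iterBlockOf (n + 1) w) ∨ (C.tgt = iterBlockOf (n + 1) x ∧ C.src = iterBlockOf (n + 1) w))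
    (c : PBond P n) (hc : blockOf c.src = iterBlockOf (n + 1) w ∧ blockOf c.tgt = iterBlockOf (n + 1) w) : c ∈ lamBondsSeq (maxDomT M₁ Z) k n := by
  have hM : 1 ≤ M₁ := by omega
  have hb : c ∈ bondsOf ((Bj M₁ Z k : DetSet P) n) := mem_bondsOf_of_outside hM2 hdiv hk hn hx hw C hC c (Or.inl hc.1)
  have hout : ∀ q : Site P n, blockOf q = iterBlockOf (n + 1) w → embIter n q ∉ maxDomT M₁ Z (n + 1) := fun q hq hqΩ =>
    hw ((mem_maxDomT_iff_of_iterBlockOf_eq hM hdiv hk (by omega) hn le_rfl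
      (show iterBlockOf (n + 1) (embIter n q) = iterBlockOf (n + 1) w by rw [iterBlockOf_succ, iterBlockOf_embIter n (by omega), hq])).1 hqΩ)
  exact mem_lamBondsSeq_maxDomT_of_embIter_not_mem hM Z hk hdiv hb (fun _ => hout _ hc.1) (fun _ => hout _ hc.2)

/-- ★ **THE OUTWARD CONNECTOR IS A PRINT MEMBER.**  Same data: the level-`(n+1)` bond `C` joining the `Γ_{n+1}`-block `B^{n+1}x` to the outside neighbour block `B^{n+1}w` belongs to
`Λ_{n+1}(Z)` — it meets `Γ_{n+1}`, the centre of `B^{n+1}x` is off `Ω_{n+2}` (a `Γ_{n+1}`-block), the centre of `B^{n+1}w` is off `Ω_{n+1} ⊇ Ω_{n+2}` (block union with `w`).  This is the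
link [II] (2.3) KEEPS, as opposed to the inward connector. [cite: Balaban1984PropagatorsII, (2.3) p.224; Balaban1988Convergent, (2.2) p.255, (2.13) pp.256–257] -/
theorem connector_mem_lamBondsSeq (hM2 : 2 ≤ M₁) (hdiv : side P.L M₁ k ∣ P.sitesPerDir 0) (hk : k ≤ P.m + P.K) {n : ℕ} (hn : n + 1 ≤ k)
    {x w : Site P 0} (hx : iterBlockOf (n + 1) x ∈ (Bj M₁ Z k : DetSet P) (n + 1)) (hw : w ∉ maxDomT M₁ Z (n + 1))
    (C : PBond P (n + 1)) (hC : (C.src = iterBlockOf (n + 1) x ∧ C.tgt = iterBlockOf (n + 1) w) ∨ (C.tgt = iterBlockOf (n + 1) x ∧ C.src = iterBlockOf (n + 1) w)) :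
    C ∈ lamBondsSeq (maxDomT M₁ Z) k (n + 1) := by
  have hM : 1 ≤ M₁ := by omega
  have hb : C ∈ bondsOf ((Bj M₁ Z k : DetSet P) (n + 1)) := by
    rcases hC with ⟨h1, -⟩ | ⟨h1, -⟩
    · exact Or.inl (by rw [h1]; exact hx)
    · exact Or.inr (by rw [h1]; exact hx)
  have h0 : n + 1 < k → embIter (n + 1) (iterBlockOf (n + 1) x) ∉ maxDomT M₁ Z (n + 1 + 1) := fun hlt =>
    embIter_not_mem_maxDomT_succ hM2 hdiv hk hlt hx
  have h1 : embIter (n + 1) (iterBlockOf (n + 1) w) ∉ maxDomT M₁ Z (n + 1 + 1) := fun hmem =>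
    hw ((mem_maxDomT_iff_of_iterBlockOf_eq hM hdiv hk (by omega) hn le_rfl
      (iterBlockOf_embIter (n + 1) (by omega) (iterBlockOf (n + 1) w))).1 (maxDomT_antitone hM Z (Nat.le_succ (n + 1)) hmem))
  rcases hC with ⟨hs, ht⟩ | ⟨ht, hs⟩
  · exact mem_lamBondsSeq_maxDomT_of_embIter_not_mem hM Z hk hdiv hb (fun hlt => by rw [hs]; exact h0 hlt) (fun _ => by rw [ht]; exact h1)
  · exact mem_lamBondsSeq_maxDomT_of_embIter_not_mem hM Z hk hdiv hb (fun _ => by rw [hs]; exact h1) (fun hlt => by rw [ht]; exact h0 hlt)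

/-- ★ **A SAME-LEVEL BOND BETWEEN TWO `Γ_J`-BLOCKS IS A PRINT MEMBER**: a `J`-bond whose two ends are sites of `Γ_J^{(J)} = 𝐁_k(Z)_J` (`J ≤ k`, `M₁ ≥ 2`) belongs to `Λ_J(Z)` — both
end-centres are off `Ω_{J+1}` (`N12BjAcrossChains.embIter_not_mem_maxDomT_succ`). [cite: Balaban1984PropagatorsII, (2.3) p.224; Balaban1988Convergent, (2.2) p.255] -/
theorem adjacent_mem_lamBondsSeq (hM2 : 2 ≤ M₁) (hdiv : side P.L M₁ k ∣ P.sitesPerDir 0) (hk : k ≤ P.m + P.K) {J : ℕ} {c : PBond P J}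
    (hs : c.src ∈ (Bj M₁ Z k : DetSet P) J) (ht : c.tgt ∈ (Bj M₁ Z k : DetSet P) J) : c ∈ lamBondsSeq (maxDomT M₁ Z) k J :=
  mem_lamBondsSeq_maxDomT_of_embIter_not_mem (by omega) Z hk hdiv (Or.inl hs)
    (fun hlt => embIter_not_mem_maxDomT_succ hM2 hdiv hk hlt hs) (fun hlt => embIter_not_mem_maxDomT_succ hM2 hdiv hk hlt ht)

/-- ★ **THE FACE-LAYER ALTERNATIVE IS VOID AT PRINT's DATUM**: if the `J`-block of `z` is a member (`J ≥ 1`), NO bond of `Λ_{J−1}(Z)` has the `(J−1)`-block of `z` as an end — that block's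
centre lies in `Ω_J` (block union with `z`), i.e. such a bond would be an INWARD connector, which [II] (2.3) drops (`B15DeterminingSetsBEndpoints.embIter_not_mem_of_mem_lamBondsSeq`).
Hence the (CENTRE) clause of the rooted forests, read at print's datum, always returns the centre `ι_J(B^J z)`. [cite: Balaban1984PropagatorsII, (2.3) p.224; Balaban1988Convergent, (2.2) p.255, (2.13) pp.256–257] -/
theorem not_faceLayer_lamBondsSeq (hM2 : 2 ≤ M₁) (hdiv : side P.L M₁ k ∣ P.sitesPerDir 0) (hk : k ≤ P.m + P.K) {J : ℕ} (hJ1 : 1 ≤ J)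
    {z : Site P 0} (hz : iterBlockOf J z ∈ (Bj M₁ Z k : DetSet P) J) :
    ¬ (1 ≤ J ∧ ∃ c ∈ lamBondsSeq (maxDomT M₁ Z) k (J - 1), (iterBlockOf (J - 1) z = c.src ∨ iterBlockOf (J - 1) z = c.tgt)) := by
  have hM : 1 ≤ M₁ := by omega
  have hJk : J ≤ k := le_of_iterBlockOf_mem_Bj hz
  rintro ⟨-, c₀, hc₀, hcz₀⟩
  obtain ⟨n, rfl⟩ : ∃ n, J = n + 1 := ⟨J - 1, by omega⟩
  -- `n + 1 - 1` is `n` by computation: re-read the data at level `n`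
  obtain ⟨c, hc, hcz⟩ : ∃ c : PBond P n, c ∈ lamBondsSeq (maxDomT M₁ Z) k n ∧ (iterBlockOf n z = c.src ∨ iterBlockOf n z = c.tgt) := ⟨c₀, hc₀, hcz₀⟩
  have hzΩ : z ∈ maxDomT M₁ Z (n + 1) := mem_maxDomT_of_iterBlockOf_mem_Bj hM hdiv hk hJ1 hz
  obtain ⟨hs, ht⟩ := embIter_not_mem_of_mem_lamBondsSeq (maxDomT M₁ Z) hk (show n < k by omega)
    (isBlockUnion_maxDomT hM (Ω := Z) hdiv hJ1 hJk (hJk.trans hk)) hc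
  have hctr : embIter n (iterBlockOf n z) ∈ maxDomT M₁ Z (n + 1) :=
    (mem_maxDomT_iff_of_iterBlockOf_eq hM hdiv hk hJ1 hJk le_rfl
      (show iterBlockOf (n + 1) (embIter n (iterBlockOf n z)) = iterBlockOf (n + 1) z by
        rw [iterBlockOf_succ, iterBlockOf_embIter n (by omega)]; rfl)).2 hzΩ
  rcases hcz with h | h
  · exact hs (by rw [← h]; exact hctr)
  · exact ht (by rw [← h]; exact hctr)

/-- **THE PRINT (CENTRE) CLAUSE FORCES `root z = ι_J(B^J z)`** at every site whose `J`-block is a member (`J ≥ 1`): the face-layer alternative is void (`not_faceLayer_lamBondsSeq`).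
[cite: Balaban1984PropagatorsII, (2.3) p.224; Balaban1988Convergent, (2.13) pp.256–257; Balaban1985Variational, (4) p.278] -/
theorem root_eq_centre_of_hcentre_lam (hM2 : 2 ≤ M₁) (hdiv : side P.L M₁ k ∣ P.sitesPerDir 0) (hk : k ≤ P.m + P.K) {J : ℕ} (hJ1 : 1 ≤ J)
    {z : Site P 0} (hz : iterBlockOf J z ∈ (Bj M₁ Z k : DetSet P) J) {root : Site P 0 → Site P 0}
    (hcentre : ((1 ≤ J ∧ ∃ c ∈ lamBondsSeq (maxDomT M₁ Z) k (J - 1), (iterBlockOf (J - 1) z = c.src ∨ iterBlockOf (J - 1) z = c.tgt)) ∧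
        root z = embIter (J - 1) (iterBlockOf (J - 1) z)) ∨
      (¬ (1 ≤ J ∧ ∃ c ∈ lamBondsSeq (maxDomT M₁ Z) k (J - 1), (iterBlockOf (J - 1) z = c.src ∨ iterBlockOf (J - 1) z = c.tgt)) ∧
        root z = embIter J (iterBlockOf J z))) :
    root z = embIter J (iterBlockOf J z) := by
  rcases hcentre with ⟨hface, -⟩ | ⟨-, h⟩
  · exact absurd hface (not_faceLayer_lamBondsSeq hM2 hdiv hk hJ1 hz)
  · exact h

end Membership

/-! ## §2  Across `∂Ω_{n+1}` through print members -/

section Across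

variable {M₁ k : ℕ} {Z : Set (Site P 0)}

/-- ★★ **CHAINS ACROSS `∂Ω_{n+1}` THROUGH PRINT MEMBERS, GRADED** — `N12BjAcrossChains.exists_chain_across_graded` with every link a member of PRINT's datum
`lamBondsSeq (maxDomT M₁ Z) k` ([II] (2.3)): the coarse link is the OUTWARD connector from the `Γ_{n+1}`-block `B^{n+1}x` to the outside neighbour block `B^{n+1}w` (`connector_mem_lamBondsSeq`),
the fine links are level-`n` bonds INSIDE that neighbour block (`mem_lamBondsSeq_of_outside`); words, lengths, consecutiveness and grades VERBATIM (the parent's proof text with the two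
membership certificates exchanged).  Data: the `(n+1)`-block of `x` a member, `w ∉ Ω_{n+1}`, a level-`(n+1)` bond `C` joining the two blocks; conclusions (a) the `n`-block of `w` is a member
of level `n`, (b) a chain of `≤ d·(L−1)∕2 + 1` print links from `ι_{n+1} B^{n+1}x` to `ι_n(B^n w)`, (c) the same backwards.
[cite: Balaban1984PropagatorsII, (2.3) p.224; Balaban1988Convergent, (2.2) p.255, (2.13) pp.256–257; Balaban1985Variational, (16)–(18) p.280; Balaban1985RegularSpaces, (1.7) p.77] -/
theorem exists_chain_across_lam_graded (hM2 : 2 ≤ M₁) (hdiv : side P.L M₁ k ∣ P.sitesPerDir 0) (hk : k ≤ P.m + P.K) {n : ℕ} (hn : n + 1 ≤ k)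
    {x w : Site P 0} (hx : iterBlockOf (n + 1) x ∈ (Bj M₁ Z k : DetSet P) (n + 1)) (hw : w ∉ maxDomT M₁ Z (n + 1))
    (C : PBond P (n + 1)) (hC : (C.src = iterBlockOf (n + 1) x ∧ C.tgt = iterBlockOf (n + 1) w) ∨ (C.tgt = iterBlockOf (n + 1) x ∧ C.src = iterBlockOf (n + 1) w)) :
    iterBlockOf n w ∈ (Bj M₁ Z k : DetSet P) n ∧
    (∃ links : List ((m : ℕ) × (PBond P m × Bool)), links.length ≤ P.d * ((P.L - 1) / 2) + 1 ∧
      (∀ l ∈ links, l.1 ≤ n + 1 ∧ l.1 ≤ k ∧ l.2.1 ∈ lamBondsSeq (maxDomT M₁ Z) k l.1) ∧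
      walkEnd (embIter (n + 1) (iterBlockOf (n + 1) x)) (links.map fun l => List.replicate (P.L ^ l.1) (l.2.1.dir, l.2.2)).flatten = embIter n (iterBlockOf n w) ∧
      ∀ (pre post : List ((m : ℕ) × (PBond P m × Bool))) (l : (m : ℕ) × (PBond P m × Bool)), links = pre ++ l :: post →
        (l.2.2 = true → walkEnd (embIter (n + 1) (iterBlockOf (n + 1) x)) (pre.map fun l => List.replicate (P.L ^ l.1) (l.2.1.dir, l.2.2)).flatten = embIter l.1 l.2.1.src) ∧
        (l.2.2 = false → walkEnd (embIter (n + 1) (iterBlockOf (n + 1) x)) (pre.map fun l => List.replicate (P.L ^ l.1) (l.2.1.dir, l.2.2)).flatten = embIter l.1 l.2.1.tgt)) ∧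
    (∃ links : List ((m : ℕ) × (PBond P m × Bool)), links.length ≤ P.d * ((P.L - 1) / 2) + 1 ∧
      (∀ l ∈ links, l.1 ≤ n + 1 ∧ l.1 ≤ k ∧ l.2.1 ∈ lamBondsSeq (maxDomT M₁ Z) k l.1) ∧
      walkEnd (embIter n (iterBlockOf n w)) (links.map fun l => List.replicate (P.L ^ l.1) (l.2.1.dir, l.2.2)).flatten = embIter (n + 1) (iterBlockOf (n + 1) x) ∧
      ∀ (pre post : List ((m : ℕ) × (PBond P m × Bool))) (l : (m : ℕ) × (PBond P m × Bool)), links = pre ++ l :: post →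
        (l.2.2 = true → walkEnd (embIter n (iterBlockOf n w)) (pre.map fun l => List.replicate (P.L ^ l.1) (l.2.1.dir, l.2.2)).flatten = embIter l.1 l.2.1.src) ∧
        (l.2.2 = false → walkEnd (embIter n (iterBlockOf n w)) (pre.map fun l => List.replicate (P.L ^ l.1) (l.2.1.dir, l.2.2)).flatten = embIter l.1 l.2.1.tgt)) := by
  have hn1 : n + 1 ≤ P.m + P.K := hn.trans hk
  set B₀ : Site P (n + 1) := iterBlockOf (n + 1) x with hB₀
  set B₁ : Site P (n + 1) := iterBlockOf (n + 1) w with hB₁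
  have hmemw : iterBlockOf n w ∈ (Bj M₁ Z k : DetSet P) n := mem_Bj_pred_of_outside hM2 hdiv hk hn hx hw C hC rfl
  have hmemn : ∀ c : PBond P n, blockOf c.src = B₁ ∧ blockOf c.tgt = B₁ → n ≤ n + 1 ∧ n ≤ k ∧ c ∈ lamBondsSeq (maxDomT M₁ Z) k n := fun c hc =>
    ⟨Nat.le_succ n, by omega, mem_lamBondsSeq_of_outside hM2 hdiv hk hn hx hw C hC c hc⟩
  have hmemC : n + 1 ≤ n + 1 ∧ n + 1 ≤ k ∧ C ∈ lamBondsSeq (maxDomT M₁ Z) k (n + 1) :=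
    ⟨le_rfl, hn, connector_mem_lamBondsSeq hM2 hdiv hk hn hx hw C hC⟩
  have hblkw : blockOf (iterBlockOf n w) = B₁ := rfl
  have hblke : blockOf (emb B₁) = B₁ := Site.blockOf_emb hn1 B₁
  have hctr : embIter (n + 1) B₁ = embIter n (emb B₁) := rfl
  -- (b): the coarse link first, then the path inside `B₁` from its centre to `B^n w`
  have mkB : ∀ lC : (m : ℕ) × (PBond P m × Bool), (lC.1 ≤ n + 1 ∧ lC.1 ≤ k ∧ lC.2.1 ∈ lamBondsSeq (maxDomT M₁ Z) k lC.1) →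
      ((lC.2.2 = true → embIter (n + 1) B₀ = embIter lC.1 lC.2.1.src) ∧ (lC.2.2 = false → embIter (n + 1) B₀ = embIter lC.1 lC.2.1.tgt)) →
      walkEnd (embIter (n + 1) B₀) ([lC].map fun l => List.replicate (P.L ^ l.1) (l.2.1.dir, l.2.2)).flatten = embIter (n + 1) B₁ →
      ∃ links : List ((m : ℕ) × (PBond P m × Bool)), links.length ≤ P.d * ((P.L - 1) / 2) + 1 ∧
        (∀ l ∈ links, l.1 ≤ n + 1 ∧ l.1 ≤ k ∧ l.2.1 ∈ lamBondsSeq (maxDomT M₁ Z) k l.1) ∧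
        walkEnd (embIter (n + 1) B₀) (links.map fun l => List.replicate (P.L ^ l.1) (l.2.1.dir, l.2.2)).flatten = embIter n (iterBlockOf n w) ∧
        ∀ (pre post : List ((m : ℕ) × (PBond P m × Bool))) (l : (m : ℕ) × (PBond P m × Bool)), links = pre ++ l :: post →
          (l.2.2 = true → walkEnd (embIter (n + 1) B₀) (pre.map fun l => List.replicate (P.L ^ l.1) (l.2.1.dir, l.2.2)).flatten = embIter l.1 l.2.1.src) ∧
          (l.2.2 = false → walkEnd (embIter (n + 1) B₀) (pre.map fun l => List.replicate (P.L ^ l.1) (l.2.1.dir, l.2.2)).flatten = embIter l.1 l.2.1.tgt) := by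
    intro lC hlCmem hlCst hlCend
    obtain ⟨ch, hlen, hmem, hend, hcons⟩ := exists_blockWalk_centre hn1 (emb B₁) (iterBlockOf n w) B₁ hblke hblkw (Or.inl rfl)
    obtain ⟨hend', hcons'⟩ := chain_of_levelWalk (emb B₁) ch hcons
    rw [hend] at hend'
    refine ⟨[lC] ++ ch.map (fun l => (⟨n, l⟩ : (m : ℕ) × (PBond P m × Bool))), ?_, ?_, ?_, ?_⟩
    · rw [List.length_append, List.length_singleton, List.length_map]; omega
    · intro l hl
      rcases List.mem_append.mp hl with hl | hl
      · rw [List.mem_singleton.mp hl]; exact hlCmem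
      · obtain ⟨l₀, hl₀, rfl⟩ := List.mem_map.mp hl
        exact hmemn l₀.1 (hmem l₀ hl₀)
    · rw [walkEnd_flatten_append, hlCend, hctr]
      exact hend'
    · refine links_append _ _ _ (cons_single lC _ hlCst) fun pre post l h => ?_
      rw [hlCend, hctr]
      exact hcons' pre post l h
  -- (c): the path inside `B₁` from `B^n w` to its centre, then the coarse link
  have mkC : ∀ lC : (m : ℕ) × (PBond P m × Bool), (lC.1 ≤ n + 1 ∧ lC.1 ≤ k ∧ lC.2.1 ∈ lamBondsSeq (maxDomT M₁ Z) k lC.1) →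
      ((lC.2.2 = true → embIter (n + 1) B₁ = embIter lC.1 lC.2.1.src) ∧ (lC.2.2 = false → embIter (n + 1) B₁ = embIter lC.1 lC.2.1.tgt)) →
      walkEnd (embIter (n + 1) B₁) ([lC].map fun l => List.replicate (P.L ^ l.1) (l.2.1.dir, l.2.2)).flatten = embIter (n + 1) B₀ →
      ∃ links : List ((m : ℕ) × (PBond P m × Bool)), links.length ≤ P.d * ((P.L - 1) / 2) + 1 ∧
        (∀ l ∈ links, l.1 ≤ n + 1 ∧ l.1 ≤ k ∧ l.2.1 ∈ lamBondsSeq (maxDomT M₁ Z) k l.1) ∧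
        walkEnd (embIter n (iterBlockOf n w)) (links.map fun l => List.replicate (P.L ^ l.1) (l.2.1.dir, l.2.2)).flatten = embIter (n + 1) B₀ ∧
        ∀ (pre post : List ((m : ℕ) × (PBond P m × Bool))) (l : (m : ℕ) × (PBond P m × Bool)), links = pre ++ l :: post →
          (l.2.2 = true → walkEnd (embIter n (iterBlockOf n w)) (pre.map fun l => List.replicate (P.L ^ l.1) (l.2.1.dir, l.2.2)).flatten = embIter l.1 l.2.1.src) ∧
          (l.2.2 = false → walkEnd (embIter n (iterBlockOf n w)) (pre.map fun l => List.replicate (P.L ^ l.1) (l.2.1.dir, l.2.2)).flatten = embIter l.1 l.2.1.tgt) := by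
    intro lC hlCmem hlCst hlCend
    obtain ⟨ch, hlen, hmem, hend, hcons⟩ := exists_blockWalk_centre hn1 (iterBlockOf n w) (emb B₁) B₁ hblkw hblke (Or.inr rfl)
    obtain ⟨hend', hcons'⟩ := chain_of_levelWalk (iterBlockOf n w) ch hcons
    rw [hend, ← hctr] at hend'
    refine ⟨ch.map (fun l => (⟨n, l⟩ : (m : ℕ) × (PBond P m × Bool))) ++ [lC], ?_, ?_, ?_, ?_⟩
    · rw [List.length_append, List.length_singleton, List.length_map]; omega
    · intro l hl
      rcases List.mem_append.mp hl with hl | hl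
      · obtain ⟨l₀, hl₀, rfl⟩ := List.mem_map.mp hl
        exact hmemn l₀.1 (hmem l₀ hl₀)
      · rw [List.mem_singleton.mp hl]; exact hlCmem
    · rw [walkEnd_flatten_append, hend']
      exact hlCend
    · refine links_append _ _ _ hcons' fun pre post l h => ?_
      rw [hend']
      exact cons_single lC _ hlCst pre post l h
  refine ⟨hmemw, ?_, ?_⟩
  · rcases hC with ⟨h1, h2⟩ | ⟨h1, h2⟩
    · refine mkB ⟨n + 1, C, true⟩ hmemC ⟨fun _ => by rw [h1], fun h => absurd h (by simp)⟩ ?_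
      rw [walkEnd_single ⟨n + 1, C, true⟩ _ ⟨fun _ => by rw [h1], fun h => absurd h (by simp)⟩]
      simp only [if_true]
      rw [h2]
    · refine mkB ⟨n + 1, C, false⟩ hmemC ⟨fun h => absurd h (by simp), fun _ => by rw [h1]⟩ ?_
      rw [walkEnd_single ⟨n + 1, C, false⟩ _ ⟨fun h => absurd h (by simp), fun _ => by rw [h1]⟩]
      simp only [if_false, Bool.false_eq_true]
      rw [h2]
  · rcases hC with ⟨h1, h2⟩ | ⟨h1, h2⟩
    · refine mkC ⟨n + 1, C, false⟩ hmemC ⟨fun h => absurd h (by simp), fun _ => by rw [h2]⟩ ?_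
      rw [walkEnd_single ⟨n + 1, C, false⟩ _ ⟨fun h => absurd h (by simp), fun _ => by rw [h2]⟩]
      simp only [if_false, Bool.false_eq_true]
      rw [h1]
    · refine mkC ⟨n + 1, C, true⟩ hmemC ⟨fun _ => by rw [h2], fun h => absurd h (by simp)⟩ ?_
      rw [walkEnd_single ⟨n + 1, C, true⟩ _ ⟨fun _ => by rw [h2], fun h => absurd h (by simp)⟩]
      simp only [if_true]
      rw [h1]

/-- **CHAINS ACROSS `∂Ω_{n+1}` THROUGH PRINT MEMBERS** (ungraded form, the shape of `N12BjAcrossChains.exists_chain_across`). [cite: Balaban1984PropagatorsII, (2.3) p.224; Balaban1988Convergent, (2.2) p.255, (2.13) pp.256–257] -/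
theorem exists_chain_across_lam (hM2 : 2 ≤ M₁) (hdiv : side P.L M₁ k ∣ P.sitesPerDir 0) (hk : k ≤ P.m + P.K) {n : ℕ} (hn : n + 1 ≤ k)
    {x w : Site P 0} (hx : iterBlockOf (n + 1) x ∈ (Bj M₁ Z k : DetSet P) (n + 1)) (hw : w ∉ maxDomT M₁ Z (n + 1))
    (C : PBond P (n + 1)) (hC : (C.src = iterBlockOf (n + 1) x ∧ C.tgt = iterBlockOf (n + 1) w) ∨ (C.tgt = iterBlockOf (n + 1) x ∧ C.src = iterBlockOf (n + 1) w)) :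
    iterBlockOf n w ∈ (Bj M₁ Z k : DetSet P) n ∧
    (∃ links : List ((m : ℕ) × (PBond P m × Bool)), links.length ≤ P.d * ((P.L - 1) / 2) + 1 ∧
      (∀ l ∈ links, l.1 ≤ k ∧ l.2.1 ∈ lamBondsSeq (maxDomT M₁ Z) k l.1) ∧
      walkEnd (embIter (n + 1) (iterBlockOf (n + 1) x)) (links.map fun l => List.replicate (P.L ^ l.1) (l.2.1.dir, l.2.2)).flatten = embIter n (iterBlockOf n w) ∧
      ∀ (pre post : List ((m : ℕ) × (PBond P m × Bool))) (l : (m : ℕ) × (PBond P m × Bool)), links = pre ++ l :: post →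
        (l.2.2 = true → walkEnd (embIter (n + 1) (iterBlockOf (n + 1) x)) (pre.map fun l => List.replicate (P.L ^ l.1) (l.2.1.dir, l.2.2)).flatten = embIter l.1 l.2.1.src) ∧
        (l.2.2 = false → walkEnd (embIter (n + 1) (iterBlockOf (n + 1) x)) (pre.map fun l => List.replicate (P.L ^ l.1) (l.2.1.dir, l.2.2)).flatten = embIter l.1 l.2.1.tgt)) ∧
    (∃ links : List ((m : ℕ) × (PBond P m × Bool)), links.length ≤ P.d * ((P.L - 1) / 2) + 1 ∧
      (∀ l ∈ links, l.1 ≤ k ∧ l.2.1 ∈ lamBondsSeq (maxDomT M₁ Z) k l.1) ∧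
      walkEnd (embIter n (iterBlockOf n w)) (links.map fun l => List.replicate (P.L ^ l.1) (l.2.1.dir, l.2.2)).flatten = embIter (n + 1) (iterBlockOf (n + 1) x) ∧
      ∀ (pre post : List ((m : ℕ) × (PBond P m × Bool))) (l : (m : ℕ) × (PBond P m × Bool)), links = pre ++ l :: post →
        (l.2.2 = true → walkEnd (embIter n (iterBlockOf n w)) (pre.map fun l => List.replicate (P.L ^ l.1) (l.2.1.dir, l.2.2)).flatten = embIter l.1 l.2.1.src) ∧
        (l.2.2 = false → walkEnd (embIter n (iterBlockOf n w)) (pre.map fun l => List.replicate (P.L ^ l.1) (l.2.1.dir, l.2.2)).flatten = embIter l.1 l.2.1.tgt)) := by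
  obtain ⟨hmemw, ⟨L₁, h1len, h1mem, h1end, h1cons⟩, ⟨L₂, h2len, h2mem, h2end, h2cons⟩⟩ := exists_chain_across_lam_graded hM2 hdiv hk hn hx hw C hC
  exact ⟨hmemw, ⟨L₁, h1len, fun l hl => (h1mem l hl).2, h1end, h1cons⟩, ⟨L₂, h2len, fun l hl => (h2mem l hl).2, h2end, h2cons⟩⟩

end Across

end Summit.QuantumFields.YangMills.BalabanUVNodes.N12BjAcrossChainsLam

end
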